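import Summits.KontsevichZagierPeriods.KontsevichZagierPeriods.Theses.ExpConservative

/-!
# `Assembly` (stmt-KontsevichZagierPeriods-0291, route ExpConservative) — proof

The route's assembly item
`(∀ c, KZexp.eval c = 0 → c ∈ KZexp.relations) ∧ KZexp.Conservative → KontsevichZagierPeriods`
is its gate-verified deciding theorem
`Summit.KontsevichZagierPeriods.KontsevichZagierPeriods.Theses.ExpConservative.closes
(h₁ : ExpConservativity) (h₂ : ExpKernelConjecture) : KontsevichZagierPeriods` read as an
implication: `ExpConservativity` is by definition `KZexp.Conservative` (the second conjunct) and
`ExpKernelConjecture` is by definition the first conjunct, so the pair is uncurried and swapped.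
The antecedent (exponential kernel conjecture and conservativity) is the route's pair of open
cruxes and is NOT discharged here: the theorem is the implication, nothing more. (Lead c10 of crux
stmt-KontsevichZagierPeriods-9129, banking.) No definitions are introduced.

References: M. Kontsevich, D. Zagier, *Periods* (2001), §1.2 (Conjecture 1), §4.3 (exponential
periods).
-/

namespace Summit.KontsevichZagierPeriods.ExpConservative

/-- **Assembly of route ExpConservative** (stmt-KontsevichZagierPeriods-0291): the exponential
kernel conjecture `∀ c, KZexp.eval c = 0 → c ∈ KZexp.relations` together with conservativity
`KZexp.Conservative` of the exponential calculus over the ordinary one imply the summit, by the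
route's deciding theorem `closes` (its hypotheses `ExpConservativity`, `ExpKernelConjecture` are the
two conjuncts by definition). [Kontsevich–Zagier 2001, §1.2, §4.3] [folklore] -/
theorem assembly_proof :
    Summit.KontsevichZagierPeriods.KontsevichZagierPeriods.Theses.ExpConservative.Assembly :=
  fun h =>
    Summit.KontsevichZagierPeriods.KontsevichZagierPeriods.Theses.ExpConservative.closes h.2 h.1

end Summit.KontsevichZagierPeriods.ExpConservative
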